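import Mathlib.Data.Nat.Choose.Basic
import Mathlib.Data.Fintype.BigOperators
import Mathlib.Data.Fintype.Pi
import Mathlib.Data.Finset.Powerset
import Mathlib.Algebra.Order.BigOperators.Ring.Finset
import Mathlib.Algebra.BigOperators.Ring.Finset
import Mathlib.Tactic.Linarith
import Mathlib.Tactic.Zify
import Mathlib.Tactic.Ring
import Mathlib.Order.Basic
import Literature.Computability.Complexity.CliqueCounting
import HarnessLib

/-!
# Counting lemmas for random restrictions by uniform subsets (Kumar–Saraf 2017, §8.3, Lemma 8.2)

Topic `Literature/Computability/AlgebraicComplexity`; infrastructure for the printed proof of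
`kumarSaraf2017_imm_homDepthFour` (`HomogeneousDepthFour.lean`), probabilistic side, in
COUNTING form (probabilities over a finite uniform space are ratios of cardinalities; we state
every bound cross-multiplied, in `ℕ`).

Kumar–Saraf's distribution `𝒟` (§8.3) chooses, independently for every row of every matrix, a
uniformly random subset of the row of a prescribed size (`ñ^{3/4}` first-row entries of a special
matrix, `n^η`, `2` or `1` entries per row of a regular matrix) and keeps exactly those variables
alive. The proof of Lemma 8.2 needs: a fixed set of `t` entries survives with probability at most
`(d/ñ)^t` per row (`d` = number kept in that row, `ñ` = row length), rows being independent. Here: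

* `card_powersetCard_filter_superset_mul_le` — **one row**: among the `d`-subsets `S` of an
  `ñ`-set, those containing a fixed set `A` number at most `C(ñ, d) · (d/ñ)^{|A|}`:
  `#{S : A ⊆ S} · ñ^{|A|} ≤ C(ñ, d) · d^{|A|}` (exact count `C(ñ - |A|, d - |A|)` is Mathlib's
  `Finset.card_filter_powersetCard_subset`; then `Nat.choose_mul` and the binomial comparison
  `C(d, a) · ñ^a ≤ C(ñ, a) · d^a` of `Literature.Computability.Complexity.CliqueCounting`).
* `rowSpace deg` — **the product space** of independent row choices (`Fintype.piFinset`), and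
  `card_rowSpace_filter_superset_mul_le` — **independence across rows**: the assignments in which
  every row `ρ` keeps a fixed set `A ρ` number at most `|Ω| · ∏_ρ (deg ρ / ñ)^{|A ρ|}`,
  cross-multiplied. With all `deg ρ ≤ d`: `≤ |Ω| · (d/ñ)^{∑ |A ρ|}`
  (`card_rowSpace_filter_superset_mul_le'`), the shape used in Lemma 8.2 ("the probability that
  any monomial with support at least `t` … survives is at most `1/n^t`").
* `card_filter_exists_le_sum` (union bound) and `mul_card_filter_le_sum` (Markov's inequality for
  a `ℕ`-valued function on a finite set), the two probabilistic devices of §8.6–§8.7.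

Everything is proved; folklore.

## References

* M. Kumar, S. Saraf, *On the power of homogeneous depth 4 arithmetic circuits*, SIAM J. Comput.
  46 (2017) 336–387 (arXiv:1404.1950): §8.3 (the distribution `𝒟`), Lemma 8.2, Lemma 8.7.
-/

namespace Literature.Computability.AlgebraicComplexity.KumarSaraf

/-! ### One row: uniform `d`-subsets containing a fixed set -/

section Row

variable {α : Type*} [DecidableEq α]

/-- **One row of the random restriction** (Kumar–Saraf 2017, proof of Lemma 8.2): a fixed set
`A` of entries of a row of length `ñ = |U|` is contained in a uniformly random `d`-subset with
probability at most `(d/ñ)^{|A|}`; cross-multiplied: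
`#{S ∈ C(U, d) : A ⊆ S} · ñ^{|A|} ≤ C(ñ, d) · d^{|A|}`. [cite: KumarSaraf2017, Lemma 8.2] -/
theorem card_powersetCard_filter_superset_mul_le (U A : Finset α) (d : ℕ) :
    ((Finset.powersetCard d U).filter fun S => A ⊆ S).card * U.card ^ A.card ≤
      U.card.choose d * d ^ A.card := by
  by_cases hAU : A ⊆ U
  swap
  · -- no `S ⊆ U` contains `A`
    have h0 : ((Finset.powersetCard d U).filter fun S => A ⊆ S) = ∅ := by
      rw [Finset.filter_eq_empty_iff]
      intro S hS hAS
      exact hAU (hAS.trans (Finset.mem_powersetCard.1 hS).1)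
    rw [h0, Finset.card_empty, zero_mul]
    exact Nat.zero_le _
  by_cases hAd : A.card ≤ d
  swap
  · have h0 : ((Finset.powersetCard d U).filter fun S => A ⊆ S) = ∅ := by
      rw [Finset.filter_eq_empty_iff]
      intro S hS hAS
      have := Finset.card_le_card hAS
      rw [(Finset.mem_powersetCard.1 hS).2] at this
      omega
    rw [h0, Finset.card_empty, zero_mul]
    exact Nat.zero_le _
  by_cases hdU : d ≤ U.card
  swap
  · have h0 : Finset.powersetCard d U = ∅ := Finset.powersetCard_eq_empty.2 (by omega)
    rw [h0, Finset.filter_empty, Finset.card_empty, zero_mul]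
    exact Nat.zero_le _
  rw [Finset.card_filter_powersetCard_subset A U d hAU hAd]
  set a := A.card
  set N := U.card
  -- `C(N-a, d-a) C(N, a) = C(N, d) C(d, a)` (`Nat.choose_mul`) and `C(d,a) N^a ≤ C(N,a) d^a`
  have hmul : N.choose d * d.choose a = N.choose a * (N - a).choose (d - a) :=
    Nat.choose_mul hAd
  have hpos : 0 < N.choose a := Nat.choose_pos (hAd.trans hdU)
  have key : (N - a).choose (d - a) * N ^ a * N.choose a ≤ N.choose d * d ^ a * N.choose a :=
    calc (N - a).choose (d - a) * N ^ a * N.choose a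
        = (N.choose a * (N - a).choose (d - a)) * N ^ a := by ring
      _ = N.choose d * (d.choose a * N ^ a) := by rw [← hmul]; ring
      _ ≤ N.choose d * (N.choose a * d ^ a) :=
          Nat.mul_le_mul_left _
            (Literature.Computability.Complexity.choose_mul_pow_le_choose_mul_pow hdU a)
      _ = N.choose d * d ^ a * N.choose a := by ring
  exact Nat.le_of_mul_le_mul_right key hpos

end Row

/-! ### Independent rows: the product space of the distribution `𝒟` -/

section Rows

variable {R : Type*} [Fintype R] [DecidableEq R] {α : Type*} [DecidableEq α] [Fintype α]

/-- **The sample space of `𝒟`** (Kumar–Saraf 2017, §8.3): independently for every row `ρ`, a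
subset of the row of the prescribed size `deg ρ` (the entries kept alive).
[cite: KumarSaraf2017, §8.3] -/
def rowSpace (deg : R → ℕ) : Finset (R → Finset α) :=
  Fintype.piFinset fun ρ => Finset.powersetCard (deg ρ) (Finset.univ : Finset α)

omit [DecidableEq α] in
/-- The size of the sample space. [cite: KumarSaraf2017, §8.3] -/
theorem card_rowSpace (deg : R → ℕ) :
    (rowSpace (α := α) deg).card = ∏ ρ, (Fintype.card α).choose (deg ρ) := by
  rw [rowSpace, Fintype.card_piFinset]
  simp [Finset.card_powersetCard]

/-- Filtering a product finset by a coordinatewise condition gives a product finset. [folklore] -/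
theorem filter_piFinset_forall {δ : R → Type*} [∀ ρ, DecidableEq (δ ρ)] (t : ∀ ρ, Finset (δ ρ))
    (p : ∀ ρ, δ ρ → Prop) [∀ ρ, DecidablePred (p ρ)] :
    ((Fintype.piFinset t).filter fun ω => ∀ ρ, p ρ (ω ρ)) =
      Fintype.piFinset fun ρ => (t ρ).filter (p ρ) := by
  ext ω
  simp only [Finset.mem_filter, Fintype.mem_piFinset]
  exact ⟨fun ⟨h1, h2⟩ ρ => ⟨h1 ρ, h2 ρ⟩, fun h => ⟨fun ρ => (h ρ).1, fun ρ => (h ρ).2⟩⟩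

/-- **Independence across rows** (Kumar–Saraf 2017, proof of Lemma 8.2: "the events across
different rows are independent"): the assignments in which every row `ρ` keeps the fixed set
`A ρ` have probability at most `∏_ρ (deg ρ / ñ)^{|A ρ|}`; cross-multiplied:
`#{ω : ∀ ρ, A ρ ⊆ ω ρ} · ∏_ρ ñ^{|A ρ|} ≤ |Ω| · ∏_ρ (deg ρ)^{|A ρ|}`. [cite: KumarSaraf2017, Lemma 8.2] -/
theorem card_rowSpace_filter_superset_mul_le (deg : R → ℕ) (A : R → Finset α) :
    ((rowSpace deg).filter fun ω => ∀ ρ, A ρ ⊆ ω ρ).card * ∏ ρ, Fintype.card α ^ (A ρ).card ≤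
      (rowSpace (α := α) deg).card * ∏ ρ, deg ρ ^ (A ρ).card := by
  rw [rowSpace, filter_piFinset_forall, Fintype.card_piFinset, Fintype.card_piFinset,
    ← Finset.prod_mul_distrib, ← Finset.prod_mul_distrib]
  refine Finset.prod_le_prod (fun _ _ => Nat.zero_le _) fun ρ _ => ?_
  have h := card_powersetCard_filter_superset_mul_le (Finset.univ : Finset α) (A ρ) (deg ρ)
  rw [Finset.card_univ] at h
  rw [Finset.card_powersetCard, Finset.card_univ]
  exact h

/-- **Lemma 8.2's shape**: if every row keeps at most `d` of its `ñ` entries, a fixed set of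
entries (split by rows as `A ρ`) of total size `t = ∑ |A ρ|` survives with probability at most
`(d/ñ)^t`; cross-multiplied: `#{ω : ∀ ρ, A ρ ⊆ ω ρ} · ñ^t ≤ |Ω| · d^t`.
[cite: KumarSaraf2017, Lemma 8.2] -/
theorem card_rowSpace_filter_superset_mul_le' (deg : R → ℕ) {d : ℕ} (hdeg : ∀ ρ, deg ρ ≤ d)
    (A : R → Finset α) :
    ((rowSpace deg).filter fun ω => ∀ ρ, A ρ ⊆ ω ρ).card * Fintype.card α ^ (∑ ρ, (A ρ).card) ≤
      (rowSpace (α := α) deg).card * d ^ (∑ ρ, (A ρ).card) := by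
  rw [← Finset.prod_pow_eq_pow_sum, ← Finset.prod_pow_eq_pow_sum]
  refine (card_rowSpace_filter_superset_mul_le deg A).trans (Nat.mul_le_mul_left _ ?_)
  exact Finset.prod_le_prod (fun _ _ => Nat.zero_le _) fun ρ _ => Nat.pow_le_pow_left (hdeg ρ) _

end Rows

/-! ### Union bound and Markov's inequality, counting form -/

section Devices

/-- **Union bound**: `#{ω ∈ S : ∃ b ∈ B, p b ω} ≤ ∑_{b ∈ B} #{ω ∈ S : p b ω}`. [folklore] -/
theorem card_filter_exists_le_sum {Ω β : Type*} [DecidableEq Ω] (S : Finset Ω) (B : Finset β)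
    (p : β → Ω → Prop) [∀ b, DecidablePred (p b)] :
    (S.filter fun ω => ∃ b ∈ B, p b ω).card ≤ ∑ b ∈ B, (S.filter (p b)).card := by
  have h : (S.filter fun ω => ∃ b ∈ B, p b ω) = B.biUnion fun b => S.filter (p b) := by
    ext ω
    simp only [Finset.mem_filter, Finset.mem_biUnion]
    exact ⟨fun ⟨h1, b, hb, h2⟩ => ⟨b, hb, h1, h2⟩, fun ⟨b, hb, h1, h2⟩ => ⟨h1, b, hb, h2⟩⟩
  rw [h]
  exact Finset.card_biUnion_le

/-- **Markov's inequality**, counting form: `a · #{ω ∈ S : f ω ≥ a} ≤ ∑_{ω ∈ S} f ω`.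
[folklore] -/
theorem mul_card_filter_le_sum {Ω : Type*} (S : Finset Ω) (f : Ω → ℕ) (a : ℕ)
    [DecidablePred fun ω => a ≤ f ω] :
    a * (S.filter fun ω => a ≤ f ω).card ≤ ∑ ω ∈ S, f ω :=
  calc a * (S.filter fun ω => a ≤ f ω).card = ∑ _ω ∈ S.filter (fun ω => a ≤ f ω), a := by
        rw [Finset.sum_const_nat (fun _ _ => rfl), mul_comm]
    _ ≤ ∑ ω ∈ S.filter (fun ω => a ≤ f ω), f ω :=
        Finset.sum_le_sum fun ω hω => (Finset.mem_filter.1 hω).2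
    _ ≤ ∑ ω ∈ S, f ω :=
        Finset.sum_le_sum_of_subset_of_nonneg (Finset.filter_subset _ _) fun _ _ _ => Nat.zero_le _

end Devices

end Literature.Computability.AlgebraicComplexity.KumarSaraf
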